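import Summits.BirchSwinnertonDyer.BirchSwinnertonDyer.Theses.UniversalToricDescent
import Summits.BirchSwinnertonDyer.BirchSwinnertonDyer.Theorems.UniversalToricDescentRationalSplitIMCInclusionAtThreeClosedModuloV89

/-!
# G30 — critical-cone census at a wild supercuspidal split prime (freeze generation, D-0182)

Crux (fixed, by name): `…Theses.UniversalToricDescent.RationalSplitIMCInclusionAtThree`
(Kolyvagin direction `Ch_Λ(X_(∅,0)) ∣ 3ᵏ·L` in `R₀⟦T⟧`; `E/ℚ` wild additive `ClassO6` at `3`, `a₃ = 0`,
`ρ̄₃` onto `GL₂(𝔽₃)`, `r_an = 1`, `K` Heegner with `3 = 𝔭𝔭'` split, strict at `𝔭'`).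

This generation files NO new idea card.  KEEP/KILL g30 = g29 (no Disproof / TRIAGE / Negative for 24207,
negatives `{15532, 24881}` disjoint, LEAD `Lines/ratwall_thin_comb.lean` v12 of 2026-08-30T16:55:06Z
unchanged, 30 cards, no «COVER CLOSED 24207»; hibernation ruling D-0182 (1024) 2026-09-01T00:24:36Z).
Six further levers were examined and each reduces to a cone entry (HANDOFF-cruxidea-24207-1-g30.md §3);
the product of the generation is the barrier note B-g30-1 below, which explains WHY the single residue of
the LEAD line (item 32493, the half-ordinary value formula) cannot be reached by any critical-value
(Kato-type, dual-exponential) reciprocity law, and two smaller notes B-g30-2/3.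

## B-g30-1  CRITICAL-CONE UNREACHABILITY (sharpens B-g10-2 from «not in print» to bookkeeping)
For the Rankin–Selberg pair `(f, g)` of weights `(k+2, k'+2)` and cyclotomic twist `j`, geometric
(motivic) Beilinson–Flach classes exist exactly for `0 ≤ j ≤ min k k'`, while `L(f ⊗ g, 1+j)` is critical
exactly for `min k k' < j ≤ max k k'` … precisely `k+1 ≤ j ≤ k'` when `k ≤ k'`.  The two ranges are
DISJOINT for every `(k, k', j)` (§A, `bf_geometric_critical_disjoint`), and for `f = f_E` of weight 2
(`k = 0`) the geometric range is the single point `j = 0` (§A, `bf_geometric_range_weight_two`).  A critical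
specialisation of a BF family through `f_E` therefore requires a `p`-adic deformation in a direction that
moves `j` or `k`: the cyclotomic direction needs a `U₃`-stabilisation of `f_E` (eigenvalue `α_f`; here
`U₃ f_E = 0`, infinite slope), the weight direction needs a family through `f_E` (none: `D_cris = 0`,
B-g24-6), Kato's `K₂`-classes exist only over abelian extensions of `ℚ` (cyclotomic line of `K`, S2), and
generalised Heegner classes of a weight-2 form are Heegner points twisted by FINITE-order characters.  Hence
on this crux EVERY reciprocity input — on teeth, on the anticyclotomic line, at the locally algebraic
points `x = ζ·u^s − 1` (`s ≥ 1`) of the BDP range — is a NON-critical `p`-adic Beilinson formula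
(a syntomic regulator, Bloch–Kato logarithm), never a dual exponential; and a syntomic regulator of a class on
`Y₁(27N') × Y₁(N_θ)` localises (ω_f = dF_E exact on the ordinary region, `F_E = d⁻¹f_E` overconvergent since
the `f_E`-eigenspace of `H¹_rig` of the ordinary wide open is zero) to the supersingular tubes of the stable
fibre of `X₁(27N')` over the wild extension (Weinstein; Imai–Tsushima for conductor `27`).  Consequence for
staffing: the residue of 32493 is ONE computation class («stable-fibre regulator», utd-p1 #1 / g19
`disc-exact-crystalline-teeth`), not a family of alternative reciprocity laws; a restart should seat it as a
single research atom.  Refs: KLZ17 [arXiv:1503.02888 §§6–10, Rem. 10.2.3], KLZ20 (p-adic Beilinson),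
LZ16 [arXiv:1506.06703], Kato 2004 §§8–12, BDP13 §4 (weight 2: `r = 0`), Weinstein 2016, Imai–Tsushima 2021.

## B-g30-2  LOCALLY-ALGEBRAIC ACCUMULATION DOOR = g5 ∘ g6(iii), NO SUPPLY
Uniform pointwise rank-0 Bloch–Kato inequalities `ℓ(Sel_BK(K, T ⊗ ψ_x⁻¹)) ≤ v(L(x)) + k` at the
θ-dominant points `x = ζu^s − 1` would force `ord_α F ≤ ord_α L` at every root `α` in the closure
`{1+α ∈ μ_{3^∞}·u^{ℤ₃}}` and leave the irrational leaf; but (i) by B-g30-1 there is no class at any such `x`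
(no Euler system reaches a critical point), (ii) the door is `bounded-resolvent-twist-door` restricted to a
dense set composed with `root-trichotomy-rank-cap` (iii), and (iii) the irrational leaf needs a `Λ`-adic class
anyway (identity principle) — variant, not filed.

## B-g30-3  EVEN HOST `M = KK'/F` — SIGN BOOKKEEPING (re-derives B-g29-3 (i))
With `K'` imaginary, `3` inert in `K'`, `F = ℚ(√(d_K d_{K'}))` real with `3` inert and `w = WW'` split in
`M/F`, `BC_F(f_E) ⊗ Θ⁻¹` has finite slope 1 at `w`; but `E/M = E/K ⊕ E^{(K')}/K` and the primes of
`d_{K'}` enter `N(E^{(K')})` squared, so `ε(E^{(K')}/K, χ) = ε(E/K, χ) = −1` for every anticyclotomic `χ`,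
`ε(E_F/M, χ) = +1` with `L(E_F/M, χ, 1) ≡ 0` (§B toy `sign_product_toy`): every `M`-CM carrier over `F`
is definite and identically zero, while the `(∅,0)`/BDP object over `M` factors as crux(`E`) ⊕
crux(`E^{(K')}`) — the host adds no supply (and no BF analogue exists over real quadratic `F`: Hilbert
modular surfaces have no units by Koecher, `H³` is Eisenstein; LLZ18 is Asai = `Sym² ⊕ det`).

## Pieces and leaves (D-0171)
* Door (BY NAME): LEAD composition `V89.RationalSplitIMCInclusionAtThree_of_existsOfBDP_of_jacquet_of_nekovar_of_ratCombDvd`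
  re-exported below (`rationalSplitIMCInclusionAtThree_of_leadLine_g30`).  Pieces: `stub_printInputs`
  WEAKER · ATTACKABLE (print, p = 3 adaptation; LEAD-CENSUS-g12 table); `stub_toricFrameExistsOfBDP`
  WEAKER · ATTACKABLE (Hida 1988 + CW23 2.11; tree `IsToricTwoVarLFunctionUpTo₂` p739474);
  `stub_ratCombDvdUpTo2` = item 32493 UNDECIDED · BARRIER-ADJACENT (open conjecture in print, Gu
  arXiv:2512.01184 Conj. 2.15; by B-g30-1 its residue is the single computation class «syntomic regulator
  on the stable fibre of `X₁(27N')`», leaf IDEA-NEEDED/INSTRUMENTABLE on conductor-27 rows first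
  (Imai–Tsushima affinoids explicit)).
* No EQUIV node is introduced; no child needed.

References: [cite: Gu2025FiniteSlopeUniversalRS, Conj. 2.15 (arXiv:2512.01184)]
[cite: KLZ2017RankinEisenstein (arXiv:1503.02888)] [cite: LoefflerZerbes2016Coleman (arXiv:1506.06703)]
[cite: Nekovar2006, §10.7] [cite: Weinstein2016SemistableModels] [cite: ImaiTsushima2021AffinoidsWild].
-/

set_option autoImplicit false
set_option linter.dupNamespace false

namespace Summit.BirchSwinnertonDyer.BirchSwinnertonDyer.Cruxes.RationalSplitIMCInclusionAtThree.CriticalConeCensusG30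

/-! ### §A  The weight/twist bookkeeping behind B-g30-1 -/

/-- **B-g30-1 (toy, general weights).**  The geometric range `j ≤ min k k'` of Beilinson–Flach classes and
the critical range `k+1 ≤ j ≤ k'` of `L(f ⊗ g, 1+j)` (for `k ≤ k'`) are disjoint. -/
theorem bf_geometric_critical_disjoint (k k' j : ℕ) :
    ¬ (j ≤ min k k' ∧ (k + 1 ≤ j ∧ j ≤ k')) := by
  rintro ⟨hgeo, hcrit, -⟩
  have : j ≤ k := le_trans hgeo (Nat.min_le_left k k')
  omega

/-- **B-g30-1 (toy, weight two).**  For `f` of weight 2 (`k = 0`) the geometric range is `{0}`: a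
geometric Beilinson–Flach class through `f_E` has twist `j = 0`, whatever the weight `k'+2` of `g`. -/
theorem bf_geometric_range_weight_two (k' j : ℕ) (hgeo : j ≤ min 0 k') : j = 0 := by
  have : j ≤ 0 := le_trans hgeo (Nat.min_le_left 0 k')
  omega

/-- **B-g30-1 (toy, no critical point on a weight-two tooth).**  With `k = 0` no twist `j` is both
geometric and critical, for any `k'`. -/
theorem no_geometric_critical_point_weight_two (k' j : ℕ) :
    ¬ (j ≤ min 0 k' ∧ (1 ≤ j ∧ j ≤ k')) := by
  simpa using bf_geometric_critical_disjoint 0 k' j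

/-! ### §B  The sign bookkeeping behind B-g30-3 -/

/-- **B-g30-3 (toy).**  Two factors of sign `−1` give a motive of sign `+1` over the host: the definite
setting, whose central values vanish identically because each factor's does. -/
theorem sign_product_toy : ((-1 : ℤˣ) * (-1 : ℤˣ)) = 1 := by
  simp

/-- **B-g30-3 (toy, factorisation).**  If both factors of a product vanish at the centre then so does the
product — the definite θ-element over the even host is identically zero. -/
theorem central_value_product_vanishes {R : Type*} [CommRing R] (L₁ L₂ : R) (h₁ : L₁ = 0) :
    L₁ * L₂ = 0 := by
  simp [h₁]

/-! ### §C  Door (S1, BY NAME) -/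

/-- **CENSUS DOOR (S1, BY NAME), generation 30.**  The only unfenced supply class remains S1 (Beilinson–Flach
along the ordinary CM family through `θ_ψ`, specialised at `f_E`); its door is the LEAD composition
(toric frame above the BDP frame ⊕ Jacquet ⊕ Nekovář ⊕ item 32493 `RatThinCombDvdUpToTwoAtThree` ⟹ the
crux BY NAME), re-exported verbatim.  By B-g30-1 the open piece 32493 has exactly one residue form
(non-critical syntomic regulator at wild level 27). -/
alias rationalSplitIMCInclusionAtThree_of_leadLine_g30 :=
  Summit.BirchSwinnertonDyer.BirchSwinnertonDyer.Theorems.UniversalToricDescentRatwallThinCombLine.V89.RationalSplitIMCInclusionAtThree_of_existsOfBDP_of_jacquet_of_nekovar_of_ratCombDvd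

end Summit.BirchSwinnertonDyer.BirchSwinnertonDyer.Cruxes.RationalSplitIMCInclusionAtThree.CriticalConeCensusG30
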